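import Mathlib
import Summits.AtomisticToContinuum.Crystallization.Theses.GappedShellCensus
import Summits.AtomisticToContinuum.Crystallization.Theorems.GappedShellCensusCleanLimitsHaveWindowsReduction
import Literature.MathematicalPhysics.StatisticalMechanics.BarlowStacking
import Literature.MathematicalPhysics.StatisticalMechanics.LocalMatchingCompactness
import Literature.Geometry.DiscreteGeometry.KissingPatterns

/-!
# Kernel sketch for `stub_laminarClosing` of line `laminar_chain` (crux stmt-AtomisticToContinuum-15932)

Strategist workfile (planner-cstrat-stmt-AtomisticToContinuum-15932-s1-0, 2026-08-17): the TYPED sub-structure of the kernel stub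
L2 `LaminarChain.stub_laminarClosing` (GS + rooted clean recurrent charted hull element ⇒ LAMINAR), for the lead / crux-plan that
adopts the line. Nothing here is registered; the three `kernel_*` statements are the intended reshape of L2 into
(a) a GROUND-STATE-FREE coercivity in the T2 shape of the live line but with the LAMINAR DEFECT (position misfit of the bond shell
against the 12-parameter laminar slot family — arbitrary generators `u, v`, arbitrary upper/lower apex offsets `w₁, w₂`) in place of
`localDefect`; (b) the density closing at the set (pattern: the landed `CleanHull.stub_closing`, with a laminar analogue of
`stub_defectLipschitz`); (c) laminar rigidity (zero laminar defect everywhere ⇒ the global laminar form; pattern: the landed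
`stub_layeredOfExactShells` chain). The composition `stub_laminarClosing_of_kernel` re-derives L2's statement VERBATIM from (a)–(c)
(kernel-checked, sorry-free modulo the three). New vocabulary (`laminarSlotC/H`, `posMisfit`, `laminarDefect`) is defined here and
would have to land in a `…LaminarDefs.lean` (prover-only) before (a)–(c) can be registered as stubs.

Why (a) is smaller than `stub_trussCoercivity`: `laminarDefect ≤` the misfit against the window's OWN-CLASS-MEAN laminar competitor,
whose energy is compared with `Z`'s by a pure Jensen step (first-order term identically zero); no homogeneous/laminar mode is claimed
coercive (metric, slips, heights are free in the slot family), so no zero-mean-stress matching enters. Probed: NUMERICS-strategist.md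
(162 configurations on the clean box, min Δ/D = 0.43).
-/

noncomputable section

namespace Summit.AtomisticToContinuum.Crystallization.Cruxes.CleanLimitsHaveWindows.LaminarChain

open scoped BigOperators
open Filter Metric
open Literature.MathematicalPhysics.StatisticalMechanics
open Literature.Geometry.DiscreteGeometry
open Summit.AtomisticToContinuum.Crystallization.Theorems

/-! ## Vocabulary: the laminar slot family and the laminar defect -/

/-- Laminar slot model of CUBIC local type: in-plane lattice hexagon `±u, ±v, ±(u − v)`, upper triangle `w₁ − {0, u, v}`, lower
triangle `w₂ + {0, u, v}` (staggered). For `u = t₁(a′)`, `v = t₂(a′)`, `w₁ = h⁺e₃ + w(a′)`, `w₂ = −h⁻e₃ − w(a′)` this is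
`CleanHull.slotC a′ h⁺ h⁻`; here `u, v, w₁, w₂` are ARBITRARY vectors (metric, registry, heights and the shell's rotation all free).
[folklore] -/
def laminarSlotC (u v w₁ w₂ : EuclideanSpace ℝ (Fin 3)) : Fin 12 → EuclideanSpace ℝ (Fin 3) :=
  ![u, -u, v, -v, u - v, v - u, w₁, w₁ - u, w₁ - v, w₂, w₂ + u, w₂ + v]

/-- Laminar slot model of HEXAGONAL local type: as `laminarSlotC` but with the lower triangle `w₂ − {0, u, v}` eclipsed with the upper
one. [folklore] -/
def laminarSlotH (u v w₁ w₂ : EuclideanSpace ℝ (Fin 3)) : Fin 12 → EuclideanSpace ℝ (Fin 3) :=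
  ![u, -u, v, -v, u - v, v - u, w₁, w₁ - u, w₁ - v, w₂, w₂ - u, w₂ - v]

/-- Position misfit of a labelled 12-cluster `q` about `p` against a slot model: `Σ_k ‖(q k − p) − slot k‖²`. [folklore] -/
def posMisfit (p : EuclideanSpace ℝ (Fin 3)) (q slot : Fin 12 → EuclideanSpace ℝ (Fin 3)) : ℝ :=
  ∑ k : Fin 12, ‖q k - p - slot k‖ ^ 2

/-- **The laminar defect** of `Z` at `p` (scale `a`): the infimum over labellings of the bond shell of `p` by `Fin 12`, over the
slot parameters `(u, v, w₁, w₂) ∈ (ℝ³)⁴` and over the two local types, of the position misfit. It vanishes iff the bond shell is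
LAMINAR: an exact lattice hexagon `p ± u, p ± v, p ± (u − v)` plus two exact translates of lattice triangles above and below — in-plane
metric, registry slips, heights and orientation all free (junk `0` if the shell does not have twelve points). [folklore] -/
def laminarDefect (a : ℝ) (Z : Set (EuclideanSpace ℝ (Fin 3))) (p : EuclideanSpace ℝ (Fin 3)) : ℝ :=
  ⨅ e : ↥(CleanHull.bondShell a Z p) ≃ Fin 12,
    ⨅ θ : (EuclideanSpace ℝ (Fin 3)) × (EuclideanSpace ℝ (Fin 3)) × (EuclideanSpace ℝ (Fin 3)) × (EuclideanSpace ℝ (Fin 3)),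
      min (posMisfit p (fun k => (e.symm k : EuclideanSpace ℝ (Fin 3))) (laminarSlotC θ.1 θ.2.1 θ.2.2.1 θ.2.2.2))
        (posMisfit p (fun k => (e.symm k : EuclideanSpace ℝ (Fin 3))) (laminarSlotH θ.1 θ.2.1 θ.2.2.1 θ.2.2.2))

/-- The position misfit is non-negative. [folklore] -/
theorem posMisfit_nonneg (p : EuclideanSpace ℝ (Fin 3)) (q slot : Fin 12 → EuclideanSpace ℝ (Fin 3)) :
    0 ≤ posMisfit p q slot :=
  Finset.sum_nonneg fun _ _ => sq_nonneg _

/-- The laminar defect is non-negative. [folklore] -/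
theorem laminarDefect_nonneg (a : ℝ) (Z : Set (EuclideanSpace ℝ (Fin 3))) (p : EuclideanSpace ℝ (Fin 3)) :
    0 ≤ laminarDefect a Z p :=
  Real.iInf_nonneg fun _ => Real.iInf_nonneg fun _ => le_min (posMisfit_nonneg _ _ _) (posMisfit_nonneg _ _ _)

/-! ## (a) Laminar coercivity — ground-state-free, T2 shape with the laminar defect -/

/-- **LAMINAR COERCIVITY** (the GS-free sufficient condition of L2; T2 shape of the live line with `laminarDefect` for `localDefect`):
there are `κ > 0`, `C` such that for every set `Z` everywhere clean at a scale `a ∈ [47/50, 1]` AND charted as the octet truss of a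
Barlow stacking, and every ball window `W = Z ∩ B̄(c, L)`, `L ≥ 1`:
`2 E_LJ(#W) − C L² + κ Σ_{p ∈ W} laminarDefect a Z p ≤ Σ_{p ∈ W} siteEnergy Z p`. `E_LJ(#W)` sits on the weak side, so a proof exhibits a
LAMINAR competitor of equal cardinality — the own-class-mean ironing of the window (Jensen in squared-bond-length class coordinates).
[folklore] -/
def LaminarCoercivity : Prop :=
  ∃ κ C : ℝ, 0 < κ ∧ ∀ (Z : Set (EuclideanSpace ℝ (Fin 3))) (a : ℝ), 47 / 50 ≤ a → a ≤ 1 →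
    (∀ y ∈ Z, ({w ∈ Z | w ≠ y ∧ dist y w ≤ a * (1 + 1 / 50)}.ncard = 12 ∧
        ∀ w ∈ Z, w ≠ y → a * (1 - 1 / 50) ≤ dist y w ∧
          (dist y w ≤ a * (1 + 1 / 50) ∨ a * (63 / 50) ≤ dist y w)) ∧
      ∃ T : Finset (EuclideanSpace ℝ (Fin 3)), (↑T : Set (EuclideanSpace ℝ (Fin 3))) =
          (fun w => a⁻¹ • (w - y)) '' {w ∈ Z | w ≠ y ∧ dist y w ≤ a * (1 + 1 / 50)} ∧
        (ShellCloseTo (1 / 5) T fccKissingPattern ∨ ShellCloseTo (1 / 5) T hcpKissingPattern)) →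
    (∃ (s : ℤ → ℤ) (Φ : EuclideanSpace ℝ (Fin 3) → EuclideanSpace ℝ (Fin 3)), IsHaggSeq s ∧
      Set.BijOn Φ (barlowStacking 1 (Real.sqrt (2 / 3)) s) Z ∧
      ∀ p ∈ barlowStacking 1 (Real.sqrt (2 / 3)) s, ∀ q ∈ barlowStacking 1 (Real.sqrt (2 / 3)) s, p ≠ q →
        (dist p q = 1 ↔ dist (Φ p) (Φ q) ≤ a * (1 + 1 / 50))) →
    ∀ (c : EuclideanSpace ℝ (Fin 3)) (L : ℝ), 1 ≤ L → ∀ W : Finset (EuclideanSpace ℝ (Fin 3)),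
      (↑W : Set (EuclideanSpace ℝ (Fin 3))) = Z ∩ Metric.closedBall c L →
      2 * groundStateEnergy lennardJones 3 W.card - C * L ^ 2 + κ * ∑ p ∈ W, laminarDefect a Z p ≤
        ∑ p ∈ W, CleanHull.siteEnergy Z p

/-- **(a) Kernel piece: laminar coercivity holds.** OPEN — the analytic kernel (Jensen/convexity in squared-length class coordinates on
the clean band, non-affinity remainder charged through the local Korn constant of the octet edge ring; recommended order: zero-mean-stress
box reduction first). [folklore] -/
theorem kernel_laminarCoercivity : LaminarCoercivity := by
  sorry

/-! ## (b) Density closing at the set: laminar coercivity + hull + recurrence ⇒ zero laminar defect -/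

/-- **(b) Kernel piece: closing.** A rooted, everywhere-clean, rooted-uniformly recurrent, charted hull element of a Lennard-Jones
ground-state sequence has identically vanishing laminar defect, given `LaminarCoercivity` (used only AT this set). Pattern: the landed
`CleanHull.stub_closing` (summed defect over balls is of surface order by (U) = `LayeredHull.stub_windowBounds`; a laminar analogue of
`stub_defectLipschitz` transfers a positive defect along recurrence; `stub_ballBoundarySum`, `stub_gridCount` verbatim). OPEN, M–L.
[folklore] -/
theorem kernel_laminarClosingOfCoercivity : LaminarCoercivity →
    ∀ x : (N : ℕ) → (Fin N → EuclideanSpace ℝ (Fin 3)),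
    (∀ N, IsGroundState lennardJones (x N)) →
    ∀ (Z : Set (EuclideanSpace ℝ (Fin 3))) (a : ℝ), 47 / 50 ≤ a → a ≤ 1 → (0 : EuclideanSpace ℝ (Fin 3)) ∈ Z →
    (∀ R ε : ℝ, 0 < ε → ∃ᶠ N in Filter.atTop, ∃ t : EuclideanSpace ℝ (Fin 3), (∀ p ∈ Z, ‖p‖ ≤ R →
        ∃ i : Fin N, dist (x N i + t) p ≤ ε) ∧ (∀ i : Fin N, ‖x N i + t‖ ≤ R → ∃ p ∈ Z, dist (x N i + t) p ≤ ε)) →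
    (∀ y ∈ Z, ({w ∈ Z | w ≠ y ∧ dist y w ≤ a * (1 + 1 / 50)}.ncard = 12 ∧ ∀ w ∈ Z, w ≠ y →
        a * (1 - 1 / 50) ≤ dist y w ∧ (dist y w ≤ a * (1 + 1 / 50) ∨ a * (63 / 50) ≤ dist y w)) ∧
        (∃ T : Finset (EuclideanSpace ℝ (Fin 3)),
        (↑T : Set (EuclideanSpace ℝ (Fin 3))) = (fun w => a⁻¹ • (w - y)) ''
            {w ∈ Z | w ≠ y ∧ dist y w ≤ a * (1 + 1 / 50)} ∧
            (ShellCloseTo (1 / 5) T fccKissingPattern ∨ ShellCloseTo (1 / 5) T hcpKissingPattern))) →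
    (∀ R ε : ℝ, 0 < ε → ∃ G : ℝ, ∀ w ∈ Z, ∃ g ∈ Z, dist g w ≤ G ∧ BallMatch ε R 0 ((fun p => p - g) '' Z) Z) →
    (∃ (s : ℤ → ℤ) (Φ : EuclideanSpace ℝ (Fin 3) → EuclideanSpace ℝ (Fin 3)), IsHaggSeq s ∧
      Set.BijOn Φ (barlowStacking 1 (Real.sqrt (2 / 3)) s) Z ∧
      ∀ p ∈ barlowStacking 1 (Real.sqrt (2 / 3)) s, ∀ q ∈ barlowStacking 1 (Real.sqrt (2 / 3)) s, p ≠ q →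
        (dist p q = 1 ↔ dist (Φ p) (Φ q) ≤ a * (1 + 1 / 50))) →
    ∀ p ∈ Z, laminarDefect a Z p = 0 := by
  sorry

/-! ## (c) Laminar rigidity: zero laminar defect everywhere ⇒ the global laminar form -/

/-- **(c) Kernel piece: laminar rigidity (geometry).** A non-empty everywhere-clean set all of whose bond shells are laminar
(`laminarDefect ≡ 0`) is globally laminar: ONE linear isometry `A`, horizontal generators `u, v` in the bond band, horizontal per-layer
offsets and strictly increasing heights with `Z = v₀ + A{ i u + j v + w m + (z m) e₃ }`. Pattern: the landed chain behind
`CleanHull.stub_layeredOfExactShells` (atlas of overlapping shells, first layer, step up/down); the only new point is that fcc-like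
laminar shells admit four normals while hcp-like ones fix it — adjacent shells overlap in ≥ 4 points, so affine frames propagate. OPEN,
L. [folklore] -/
theorem kernel_laminarRigidity : ∀ (Z : Set (EuclideanSpace ℝ (Fin 3))) (a : ℝ), 0 < a → Z.Nonempty →
    (∀ y ∈ Z, ({w ∈ Z | w ≠ y ∧ dist y w ≤ a * (1 + 1 / 50)}.ncard = 12 ∧ ∀ w ∈ Z, w ≠ y →
        a * (1 - 1 / 50) ≤ dist y w ∧ (dist y w ≤ a * (1 + 1 / 50) ∨ a * (63 / 50) ≤ dist y w)) ∧
        (∃ T : Finset (EuclideanSpace ℝ (Fin 3)),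
        (↑T : Set (EuclideanSpace ℝ (Fin 3))) = (fun w => a⁻¹ • (w - y)) ''
            {w ∈ Z | w ≠ y ∧ dist y w ≤ a * (1 + 1 / 50)} ∧
            (ShellCloseTo (1 / 5) T fccKissingPattern ∨ ShellCloseTo (1 / 5) T hcpKissingPattern))) →
    (∀ p ∈ Z, laminarDefect a Z p = 0) →
    ∃ (A : EuclideanSpace ℝ (Fin 3) →ₗᵢ[ℝ] EuclideanSpace ℝ (Fin 3)) (u v : EuclideanSpace ℝ (Fin 3))
      (w : ℤ → EuclideanSpace ℝ (Fin 3)) (z : ℤ → ℝ) (v₀ : EuclideanSpace ℝ (Fin 3)),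
      u 2 = 0 ∧ v 2 = 0 ∧ (∀ m : ℤ, w m 2 = 0) ∧
      (a * (1 - 1 / 50) ≤ ‖u‖ ∧ ‖u‖ ≤ a * (1 + 1 / 50)) ∧ (a * (1 - 1 / 50) ≤ ‖v‖ ∧ ‖v‖ ≤ a * (1 + 1 / 50)) ∧
      (a * (1 - 1 / 50) ≤ ‖u - v‖ ∧ ‖u - v‖ ≤ a * (1 + 1 / 50)) ∧ (∀ m : ℤ, z m < z (m + 1)) ∧
      Z = (fun p => p + v₀) '' {p : EuclideanSpace ℝ (Fin 3) | ∃ m i j : ℤ,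
        p = A (((i : ℝ) • u) + ((j : ℝ) • v) + w m + (z m • layerNormal 1))} := by
  sorry

/-! ## Composition: L2 `stub_laminarClosing` verbatim from (a)–(c) -/

/-- **L2 from the kernel pieces.** The statement of `LaminarChain.stub_laminarClosing`, verbatim, from laminar coercivity (a), the
closing (b) and laminar rigidity (c). [folklore] -/
theorem stub_laminarClosing_of_kernel : ∀ x : (N : ℕ) → (Fin N → EuclideanSpace ℝ (Fin 3)),
    (∀ N, IsGroundState lennardJones (x N)) →
    ∀ (Z : Set (EuclideanSpace ℝ (Fin 3))) (a : ℝ), 47 / 50 ≤ a → a ≤ 1 → (0 : EuclideanSpace ℝ (Fin 3)) ∈ Z →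
    (∀ R ε : ℝ, 0 < ε → ∃ᶠ N in Filter.atTop, ∃ t : EuclideanSpace ℝ (Fin 3), (∀ p ∈ Z, ‖p‖ ≤ R →
        ∃ i : Fin N, dist (x N i + t) p ≤ ε) ∧ (∀ i : Fin N, ‖x N i + t‖ ≤ R → ∃ p ∈ Z, dist (x N i + t) p ≤ ε)) →
    (∀ y ∈ Z, ({w ∈ Z | w ≠ y ∧ dist y w ≤ a * (1 + 1 / 50)}.ncard = 12 ∧ ∀ w ∈ Z, w ≠ y →
        a * (1 - 1 / 50) ≤ dist y w ∧ (dist y w ≤ a * (1 + 1 / 50) ∨ a * (63 / 50) ≤ dist y w)) ∧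
        (∃ T : Finset (EuclideanSpace ℝ (Fin 3)),
        (↑T : Set (EuclideanSpace ℝ (Fin 3))) = (fun w => a⁻¹ • (w - y)) ''
            {w ∈ Z | w ≠ y ∧ dist y w ≤ a * (1 + 1 / 50)} ∧
            (ShellCloseTo (1 / 5) T fccKissingPattern ∨ ShellCloseTo (1 / 5) T hcpKissingPattern))) →
    (∀ R ε : ℝ, 0 < ε → ∃ G : ℝ, ∀ w ∈ Z, ∃ g ∈ Z, dist g w ≤ G ∧ BallMatch ε R 0 ((fun p => p - g) '' Z) Z) →
    (∃ (s : ℤ → ℤ) (Φ : EuclideanSpace ℝ (Fin 3) → EuclideanSpace ℝ (Fin 3)), IsHaggSeq s ∧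
      Set.BijOn Φ (barlowStacking 1 (Real.sqrt (2 / 3)) s) Z ∧
      ∀ p ∈ barlowStacking 1 (Real.sqrt (2 / 3)) s, ∀ q ∈ barlowStacking 1 (Real.sqrt (2 / 3)) s, p ≠ q →
        (dist p q = 1 ↔ dist (Φ p) (Φ q) ≤ a * (1 + 1 / 50))) →
    ∃ (A : EuclideanSpace ℝ (Fin 3) →ₗᵢ[ℝ] EuclideanSpace ℝ (Fin 3)) (u v : EuclideanSpace ℝ (Fin 3))
      (w : ℤ → EuclideanSpace ℝ (Fin 3)) (z : ℤ → ℝ) (v₀ : EuclideanSpace ℝ (Fin 3)),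
      u 2 = 0 ∧ v 2 = 0 ∧ (∀ m : ℤ, w m 2 = 0) ∧
      (a * (1 - 1 / 50) ≤ ‖u‖ ∧ ‖u‖ ≤ a * (1 + 1 / 50)) ∧ (a * (1 - 1 / 50) ≤ ‖v‖ ∧ ‖v‖ ≤ a * (1 + 1 / 50)) ∧
      (a * (1 - 1 / 50) ≤ ‖u - v‖ ∧ ‖u - v‖ ≤ a * (1 + 1 / 50)) ∧ (∀ m : ℤ, z m < z (m + 1)) ∧
      Z = (fun p => p + v₀) '' {p : EuclideanSpace ℝ (Fin 3) | ∃ m i j : ℤ,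
        p = A (((i : ℝ) • u) + ((j : ℝ) • v) + w m + (z m • layerNormal 1))} := by
  intro x hx Z a ha ha1 h0 hH hclean hrec hchart
  have ha0 : 0 < a := by linarith
  exact kernel_laminarRigidity Z a ha0 ⟨0, h0⟩ hclean
    (kernel_laminarClosingOfCoercivity kernel_laminarCoercivity x hx Z a ha ha1 h0 hH hclean hrec hchart)

end Summit.AtomisticToContinuum.Crystallization.Cruxes.CleanLimitsHaveWindows.LaminarChain

end
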